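import Literature.NumberTheory.EllipticCurves.BSDSelmerPConverseRankZeroProofs
import Literature.NumberTheory.EllipticCurves.BSDSelmer
import Literature.NumberTheory.EllipticCurves.LeadingTerm

/-!
# The rank conjecture modulo finiteness of `Ш(E)[p^∞]`: all cells with `max(r_an, r_MW) ≤ 3` close

Write `a = ord_{s=1} L(E,s)`, `r = rank E(ℚ)`, `s_p = corank_{ℤ_p} Sel_{p^∞}(E/ℚ)`,
`t_p = corank_{ℤ_p} Ш(E/ℚ)[p^∞]`, so that `s_p = r + t_p` (tree theorem
`WeierstrassCurve.selmerCorank_eq_mordellWeilRank_add_holds`) and `Ш(E)[p^∞]` finite `↔ t_p = 0`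
(tree theorem `finite_primaryComponent_sha_iff_shaCorank_eq_zero`).

Fix a good ordinary prime `p ≥ 5` with `E[p]` irreducible (infinitely many exist for every `E/ℚ`)
and grant, as hypotheses, the named facts

* `p`-parity `s_p ≡ a (mod 2)` (`selmerCorank_mod_two_eq`; Dokchitser–Dokchitser 2010, Thm. 1.4);
* modularity, Mazur's main conjecture in the Burungale–Castella–Skinner form and Schneider's
  non-degeneracy (`exists_isNewformOf`, `burungale_castella_skinner_charIdeal_eq_padicLFunction`,
  `Schneider1985_order_charGenerator`), which give the corank-zero `p`-converse
  `s_p = 0 ⟹ a = 0` as the tree theorem `analyticRank_eq_zero_of_selmerCorank_eq_zero_of_mainConjecture`;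
* the corank-one `p`-converse `s_p = 1 ⟹ a = 1` for the curve at hand (Skinner 2020, Thm. A′;
  Burungale–Skinner–Tian–Wan 2024, Thm. 1.10);
* Gross–Zagier–Kolyvagin `a ≤ 1 ⟹ r = a` (`rank_eq_analyticRank_of_analyticRank_le_one`).

Then, **if `Ш(E)[p^∞]` is finite**:

* `analyticRank_le_mordellWeilRank_of_le_three_of_finite_shaPrimary` — `a ≤ 3 ⟹ a ≤ r`
  (`r = s_p`, `s_p ≡ a`, and `s_p ∉ {0}` resp. `∉ {1}` by the converses);
* `analyticRank_eq_mordellWeilRank_of_max_le_three_of_finite_shaPrimary` — `a ≤ 3 ∧ r ≤ 3 ⟹ a = r`;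
* `two_le_min_of_analyticRank_ne_mordellWeilRank_of_finite_shaPrimary` — if `a ≠ r` then
  `2 ≤ a`, `2 ≤ r`, `a ≡ r (mod 2)` and `4 ≤ max(a, r)`: granting finiteness of `Ш[p^∞]` at one
  such prime, the first cells of the `(a, r)`-grid not closed by published theorems are
  `(a, r) = (2, 4)` ("`rank E(ℚ) ≥ 4 ⟹ L″(E,1) = 0`" is open) and `(a, r) = (4, 2)`
  ("`L(E,1) = L′(E,1) = L″(E,1) = L‴(E,1) = 0 ⟹ rank E(ℚ) ≥ 3`" is open).

* `three_le_min_of_analyticRank_ne_mordellWeilRank_of_rankTwoConverses` — granting moreover, for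
  the curve at hand, the two RANK-TWO transfer statements `s_p = 2 ∧ r ≥ 1 ⟹ a = 2` (a corank-two
  `p`-converse) and `a = 2 ∧ r ≥ 1 ⟹ s_p = 2` (a rank-two Kolyvagin theorem) — neither is a
  theorem; in the CM setting both follow from the conjecture "`κ_p ≠ 0 ⟺ ord_{s=1} L(E,s) = 2`" on
  generalised Kato classes (Darmon–Rotger) combined with F. Castella, arXiv:2204.09608, Thm. 1 and
  Thm. 3 — the residual cells recede to `3 ≤ min(a, r)`, `5 ≤ max(a, r)`: first `(3,5)` and `(5,3)`,
  where not even a conjectural special element is available.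

References: T. and V. Dokchitser, Ann. of Math. 172 (2010), Thm. 1.4 and §1 (parity conjecture
from finiteness of Ш); C. Skinner, E. Urban, Invent. Math. 195 (2014), Thm. 2; C. Skinner, Ann. of
Math. 191 (2020), Thm. A′; R. Greenberg, LNM 1716 (1999), §1; B. Gross, D. Zagier, Invent. Math. 84
(1986); V. Kolyvagin, Izv. 52 (1988); H. Darmon, V. Rotger, Res. Math. Sci. 3 (2016) (generalised
Kato classes); F. Castella, *Generalised Kato classes on CM elliptic curves of rank 2*,
arXiv:2204.09608, Thms. 1 and 3.
-/

noncomputable section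

open WeierstrassCurve Literature.NumberTheory.EllipticCurves.ModularForms

namespace Literature.NumberTheory.EllipticCurves

variable (W : WeierstrassCurve ℚ) [W.IsElliptic] [W.IsGloballyMinimal] (p : ℕ) [Fact p.Prime]

omit [W.IsGloballyMinimal] in
/-- With `Ш(E)[p^∞]` finite, `corank_{ℤ_p} Sel_{p^∞}(E/ℚ) = rank E(ℚ)` (corank identity
`s_p = r + t_p`, Greenberg 1999 §1, a tree theorem). [cite: Greenberg1999, §1] -/
theorem selmerCorank_eq_mordellWeilRank_of_finite_shaPrimary
    (hsha : Finite (AddCommGroup.primaryComponent W.sha p)) :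
    W.selmerCorank p = W.mordellWeilRank := by
  rw [W.selmerCorank_eq_mordellWeilRank_add_holds p,
    (finite_primaryComponent_sha_iff_shaCorank_eq_zero W p).1 hsha, add_zero]

omit [W.IsGloballyMinimal] in
/-- **Parity conjecture from `p`-parity and finiteness of `Ш(E)[p^∞]`**:
`rank E(ℚ) ≡ ord_{s=1} L(E,s) (mod 2)`. [cite: DokchitserDokchitserAnnals2010, Thm. 1.4] -/
theorem mordellWeilRank_mod_two_eq_of_finite_shaPrimary (hpar : selmerCorank_mod_two_eq W p)
    (hsha : Finite (AddCommGroup.primaryComponent W.sha p)) :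
    W.mordellWeilRank % 2 = W.analyticRank % 2 := by
  have h : W.selmerCorank p % 2 = W.analyticRank % 2 := hpar
  rwa [selmerCorank_eq_mordellWeilRank_of_finite_shaPrimary W p hsha] at h

/-- **`a ≤ 3 ⟹ a ≤ r`, granting finiteness of `Ш(E)[p^∞]`** at a good ordinary `p ≥ 5` with `E[p]`
irreducible, `p`-parity, the corank-zero `p`-converse (main conjecture + Schneider, tree theorem)
and the corank-one `p`-converse at `p`: `r = s_p ≡ a (mod 2)`, `s_p = 0 ⟹ a = 0`,
`s_p = 1 ⟹ a = 1`. [cite: DokchitserDokchitserAnnals2010, Thm. 1.4]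
[cite: SkinnerUrban2014, Thm. 2] [cite: Skinner2020, Thm. A′] -/
theorem analyticRank_le_mordellWeilRank_of_le_three_of_finite_shaPrimary
    (hmod : exists_isNewformOf) (hMC : burungale_castella_skinner_charIdeal_eq_padicLFunction)
    (hS : Schneider1985_order_charGenerator)
    (hp : 5 ≤ p) (hgood : W.HasGoodReductionAtPrime p) (hord : ¬ (p : ℤ) ∣ W.frobeniusTrace p)
    (hirr : W.HasIrreducibleModPGaloisRep p) (hpar : selmerCorank_mod_two_eq W p)
    (hconv1 : W.selmerCorank p = 1 → W.analyticRank = 1)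
    (hsha : Finite (AddCommGroup.primaryComponent W.sha p)) (h3 : W.analyticRank ≤ 3) :
    W.analyticRank ≤ W.mordellWeilRank := by
  have hs := selmerCorank_eq_mordellWeilRank_of_finite_shaPrimary W p hsha
  have hpm : W.selmerCorank p % 2 = W.analyticRank % 2 := hpar
  have hconv0 : W.selmerCorank p = 0 → W.analyticRank = 0 :=
    analyticRank_eq_zero_of_selmerCorank_eq_zero_of_mainConjecture hmod hMC hS W p hp hgood hord hirr
  by_cases h0 : W.selmerCorank p = 0
  · rw [hconv0 h0]; exact Nat.zero_le _
  by_cases h1 : W.selmerCorank p = 1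
  · rw [hconv1 h1, ← hs, h1]
  omega

/-- **All cells with `max(a, r) ≤ 3` close, granting finiteness of `Ш(E)[p^∞]`** at a good ordinary
`p ≥ 5` with `E[p]` irreducible, `p`-parity, the two `p`-converses and Gross–Zagier–Kolyvagin:
`a ≤ 3 ∧ r ≤ 3 ⟹ a = r`. [cite: DokchitserDokchitserAnnals2010, Thm. 1.4] [cite: Skinner2020, Thm. A′]
[cite: GrossZagier1986] [cite: Kolyvagin1990] -/
theorem analyticRank_eq_mordellWeilRank_of_max_le_three_of_finite_shaPrimary
    (hmod : exists_isNewformOf) (hMC : burungale_castella_skinner_charIdeal_eq_padicLFunction)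
    (hS : Schneider1985_order_charGenerator)
    (hGZK : rank_eq_analyticRank_of_analyticRank_le_one)
    (hp : 5 ≤ p) (hgood : W.HasGoodReductionAtPrime p) (hord : ¬ (p : ℤ) ∣ W.frobeniusTrace p)
    (hirr : W.HasIrreducibleModPGaloisRep p) (hpar : selmerCorank_mod_two_eq W p)
    (hconv1 : W.selmerCorank p = 1 → W.analyticRank = 1)
    (hsha : Finite (AddCommGroup.primaryComponent W.sha p))
    (ha : W.analyticRank ≤ 3) (hr : W.mordellWeilRank ≤ 3) :
    W.analyticRank = W.mordellWeilRank := by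
  have hle := analyticRank_le_mordellWeilRank_of_le_three_of_finite_shaPrimary W p hmod hMC hS hp hgood
    hord hirr hpar hconv1 hsha ha
  have hpm := mordellWeilRank_mod_two_eq_of_finite_shaPrimary W p hpar hsha
  by_cases h1 : W.analyticRank ≤ 1
  · exact (hGZK W h1).1.symm
  omega

/-- **The residual cells, granting finiteness of `Ш(E)[p^∞]`.** At a good ordinary `p ≥ 5` with
`E[p]` irreducible, granting `p`-parity, the two `p`-converses and Gross–Zagier–Kolyvagin: if
`ord_{s=1} L(E,s) ≠ rank E(ℚ)` then `2 ≤ ord_{s=1} L(E,s)`, `2 ≤ rank E(ℚ)`, the two have the same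
parity, and `4 ≤ max`. The first cells not closed by published theorems are `(a, r) = (2, 4)` and
`(4, 2)`. [cite: DokchitserDokchitserAnnals2010, Thm. 1.4] [cite: Skinner2020, Thm. A′]
[cite: GrossZagier1986] [cite: Kolyvagin1990] -/
theorem two_le_min_of_analyticRank_ne_mordellWeilRank_of_finite_shaPrimary
    (hmod : exists_isNewformOf) (hMC : burungale_castella_skinner_charIdeal_eq_padicLFunction)
    (hS : Schneider1985_order_charGenerator)
    (hGZK : rank_eq_analyticRank_of_analyticRank_le_one)
    (hp : 5 ≤ p) (hgood : W.HasGoodReductionAtPrime p) (hord : ¬ (p : ℤ) ∣ W.frobeniusTrace p)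
    (hirr : W.HasIrreducibleModPGaloisRep p) (hpar : selmerCorank_mod_two_eq W p)
    (hconv1 : W.selmerCorank p = 1 → W.analyticRank = 1)
    (hsha : Finite (AddCommGroup.primaryComponent W.sha p))
    (hne : W.analyticRank ≠ W.mordellWeilRank) :
    2 ≤ W.analyticRank ∧ 2 ≤ W.mordellWeilRank ∧
      W.analyticRank % 2 = W.mordellWeilRank % 2 ∧ 4 ≤ max W.analyticRank W.mordellWeilRank := by
  have hpm := mordellWeilRank_mod_two_eq_of_finite_shaPrimary W p hpar hsha
  have ha2 : 2 ≤ W.analyticRank := by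
    by_contra h
    exact hne (hGZK W (by omega)).1.symm
  have h3 : W.analyticRank ≤ 3 → W.analyticRank ≤ W.mordellWeilRank := fun h ↦
    analyticRank_le_mordellWeilRank_of_le_three_of_finite_shaPrimary W p hmod hMC hS hp hgood hord hirr
      hpar hconv1 hsha h
  have hr2 : 2 ≤ W.mordellWeilRank := by
    rcases Nat.lt_or_ge W.analyticRank 4 with h | h
    · exact ha2.trans (h3 (by omega))
    · -- `a ≥ 4`: `r = s_p`, `s_p ≠ 0, 1` by the converses
      have hs := selmerCorank_eq_mordellWeilRank_of_finite_shaPrimary W p hsha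
      have hconv0 : W.selmerCorank p = 0 → W.analyticRank = 0 :=
        analyticRank_eq_zero_of_selmerCorank_eq_zero_of_mainConjecture hmod hMC hS W p hp hgood hord hirr
      have h0 : W.selmerCorank p ≠ 0 := fun h0 ↦ by have := hconv0 h0; omega
      have h1 : W.selmerCorank p ≠ 1 := fun h1 ↦ by have := hconv1 h1; omega
      omega
  refine ⟨ha2, hr2, hpm.symm, ?_⟩
  rcases Nat.lt_or_ge W.analyticRank 4 with h | h
  · have hle := h3 (by omega)
    -- `2 ≤ a ≤ 3`, `a ≤ r`, `a ≠ r`, same parity ⟹ `r ≥ a + 2 ≥ 4`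
    have : W.analyticRank + 2 ≤ W.mordellWeilRank := by omega
    exact le_max_of_le_right (by omega)
  · exact le_max_of_le_left h

/-- **The residual cells granting, in addition, the two rank-two transfers.** If moreover, for the
curve at hand, `s_p = 2 ∧ rank ≥ 1 ⟹ ord_{s=1} L = 2` (a corank-two `p`-converse) and
`ord_{s=1} L = 2 ∧ rank ≥ 1 ⟹ s_p = 2` (a rank-two Kolyvagin theorem) — in the CM case both are
consequences of the Darmon–Rotger conjecture `κ_p ≠ 0 ⟺ ord_{s=1} L(E,s) = 2` via Castella,
arXiv:2204.09608, Thm. 1 (`s_p = 2`, a point of infinite order `⟹ κ_p ≠ 0`) and Thm. 3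
(`κ_p ≠ 0 ⟹ dim Sel(ℚ, V_pE) = 2`); NEITHER is a theorem — then a failure `ord ≠ rank` has
`3 ≤ ord`, `3 ≤ rank`, equal parity and `5 ≤ max`: the first residual cells become `(3,5)` and
`(5,3)`. [cite: Castella2022RankTwoCM, Thms. 1 and 3] [cite: DarmonRotger2016, Conj.]
[cite: DokchitserDokchitserAnnals2010, Thm. 1.4] -/
theorem three_le_min_of_analyticRank_ne_mordellWeilRank_of_rankTwoConverses
    (hmod : exists_isNewformOf) (hMC : burungale_castella_skinner_charIdeal_eq_padicLFunction)
    (hS : Schneider1985_order_charGenerator)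
    (hGZK : rank_eq_analyticRank_of_analyticRank_le_one)
    (hp : 5 ≤ p) (hgood : W.HasGoodReductionAtPrime p) (hord : ¬ (p : ℤ) ∣ W.frobeniusTrace p)
    (hirr : W.HasIrreducibleModPGaloisRep p) (hpar : selmerCorank_mod_two_eq W p)
    (hconv1 : W.selmerCorank p = 1 → W.analyticRank = 1)
    (hconv2 : W.selmerCorank p = 2 → 1 ≤ W.mordellWeilRank → W.analyticRank = 2)
    (hkol2 : W.analyticRank = 2 → 1 ≤ W.mordellWeilRank → W.selmerCorank p = 2)
    (hsha : Finite (AddCommGroup.primaryComponent W.sha p))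
    (hne : W.analyticRank ≠ W.mordellWeilRank) :
    3 ≤ W.analyticRank ∧ 3 ≤ W.mordellWeilRank ∧
      W.analyticRank % 2 = W.mordellWeilRank % 2 ∧ 5 ≤ max W.analyticRank W.mordellWeilRank := by
  obtain ⟨ha2, hr2, hpm, _⟩ :=
    two_le_min_of_analyticRank_ne_mordellWeilRank_of_finite_shaPrimary W p hmod hMC hS hGZK hp hgood
      hord hirr hpar hconv1 hsha hne
  have hs := selmerCorank_eq_mordellWeilRank_of_finite_shaPrimary W p hsha
  have ha3 : 3 ≤ W.analyticRank := by
    by_contra h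
    have ha : W.analyticRank = 2 := by omega
    have := hkol2 ha (by omega)
    omega
  have hr3 : 3 ≤ W.mordellWeilRank := by
    by_contra h
    have hr : W.mordellWeilRank = 2 := by omega
    have := hconv2 (by omega) (by omega)
    omega
  refine ⟨ha3, hr3, hpm, ?_⟩
  rcases Nat.lt_or_ge W.analyticRank W.mordellWeilRank with h | h
  · exact le_max_of_le_right (by omega)
  · exact le_max_of_le_left (by omega)

end Literature.NumberTheory.EllipticCurves

end
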